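import Summits.Schanuel.Schanuel.Theses.RigidCore
import Literature.NumberTheory.Transcendental.ExpPointsExamples
import Literature.NumberTheory.Transcendental.ExpPointsCuspTrichotomy
import Literature.NumberTheory.Transcendental.ExpPointsCoordinateChange
import Literature.NumberTheory.Transcendental.ExpPointsGeometryBasic

/-!
# `stub_cuspEscape` (E) for the line `cusp-germ-schneider-sparsity` of crux `RigidCore.SparsityTwo`

WHAT. The geometric escape trichotomy for a `ℚ`-defined `W ⊆ ℂ² × ℂ²` of Zariski dimension `< 2`
with infinitely many `ℚ`-linearly independent exponential points: (1) a normalised log-free cusp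
ray with transcendental tail carries infinitely many ray hits, or (2) a degenerate section
`a x₀ + b x₁ = c` carries infinitely many independent hits, or (3) a fibre `eˣ = ω` does.

SOURCE / DESIGN. All mathematics lives in `Literature/NumberTheory/Transcendental/`:
hits are discrete so one coordinate is unbounded (`ExpPointsGeometryBasic.exists_unbounded_coord`);
an unbounded family accumulates on an analytic branch at infinity contained in `W`
(`ExpPointsBranchAtInfinity.exists_branch_through_hits`, via Puiseux atlases — no curve
normalisation is needed); on such a branch the cusp trichotomy holds
(`ExpPointsCuspTrichotomy.cusp_trichotomy`: branch orders, log-type ends via a uniformizer and a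
power-vs-log growth contradiction resp. `e^Λ ∉ cl ℂ(Λ)`, log-free ends via the cusp form, rays,
rotation and complex conjugation, and Ax–Schanuel for two germs in `ℂ⸨X⸩` for the algebraic-tail
dichotomy). This file only reduces the case of a polar SECOND coordinate to the first one by the
simultaneous swap of both coordinate blocks (`ExpPointsCoordinateChange`).
-/

namespace Summit.Schanuel.Schanuel.Cruxes.SparsityTwo.CuspGermSchneiderSparsity

open Filter Topology Complex Polynomial Literature.NumberTheory.Transcendental
open scoped Real

/-- The trichotomy when the FIRST coordinate is unbounded on the independent hits. -/
theorem cuspEscape_of_unbounded_fst (W : Set (Fin 2 ⊕ Fin 2 → ℂ))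
    (hW : IsDefinedOver (⊥ : Subfield ℂ) W) (hdim : zariskiDim ℂ W < 2)
    (h0 : ∀ R : ℝ, Set.Infinite {x : Fin 2 → ℂ | x ∈ indepExpPoints W ∧ R < ‖x 0‖}) :
    (∃ (s : Fin 2 ≃ Fin 2) (e : ℕ) (A : Polynomial ℂ) (g ℓu ℓv : ℂ → ℂ) (ρ : ℝ),
        let w : ℕ → ℂ := fun N => (((N : ℝ) ^ ((e : ℝ)⁻¹) : ℝ) : ℂ);
        let x : ℕ → Fin 2 → ℂ := fun N =>
          (![2 * ↑π * I * (N : ℂ) + ℓu (w N)⁻¹,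
              2 * ↑π * I * (A.eval (w N) + g (w N)⁻¹) + ℓv (w N)⁻¹] : Fin 2 → ℂ) ∘ s;
        let y : ℕ → Fin 2 → ℂ := fun N =>
          (![Complex.exp (ℓu (w N)⁻¹), Complex.exp (ℓv (w N)⁻¹)] : Fin 2 → ℂ) ∘ s;
        0 < e ∧ 0 < ρ ∧ AnalyticAt ℂ g 0 ∧ g 0 = 0 ∧ AnalyticAt ℂ ℓu 0 ∧ AnalyticAt ℂ ℓv 0 ∧
        (¬ ∃ P : MvPolynomial (Fin 2) ℂ, P ≠ 0 ∧
            ∀ᶠ z in 𝓝 (0 : ℂ), MvPolynomial.eval ![z, g z] P = 0) ∧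
        (∀ σ : ℂ, 0 < ‖σ‖ → ‖σ‖ < ρ →
          Sum.elim ((![2 * ↑π * I * σ⁻¹ ^ e + ℓu σ,
                        2 * ↑π * I * (A.eval σ⁻¹ + g σ) + ℓv σ] : Fin 2 → ℂ) ∘ s)
            ((![Complex.exp (ℓu σ), Complex.exp (ℓv σ)] : Fin 2 → ℂ) ∘ s) ∈ W) ∧
        Set.Infinite {N : ℕ | x N ∈ indepExpPoints W ∧ Complex.exp ∘ x N = y N ∧
          ∃ L : ℤ, A.eval (w N) + g (w N)⁻¹ = L}) ∨
      (∃ a b : ℤ, (a ≠ 0 ∨ b ≠ 0) ∧ ∃ c : ℂ,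
        Set.Infinite {x : Fin 2 → ℂ | x ∈ indepExpPoints W ∧ (a : ℂ) * x 0 + (b : ℂ) * x 1 = c}) ∨
      (∃ ω : Fin 2 → ℂ,
        Set.Infinite {x : Fin 2 → ℂ | x ∈ indepExpPoints W ∧ Complex.exp ∘ x = ω}) := by
  obtain ⟨e, he, N, r, hr, Φ₁, Φ₂, Φ₃, hana, hWb, hhit⟩ :=
    exists_branch_through_hits hW.isZariskiClosed hdim (T := indepExpPoints W) subset_rfl h0
  exact cusp_trichotomy hW hdim he hr hana hWb hhit

/-- **stub_cuspEscape** (E): the geometric escape trichotomy. For `W ⊆ ℂ² × ℂ²` defined over `ℚ`,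
of Zariski dimension `< 2`, with infinitely many `ℚ`-linearly independent exponential points, one of:
(1) a normalised log-free cusp ray of `W` with transcendental tail carries infinitely many ray hits;
(2) a degenerate section `a x₀ + b x₁ = c`, `(a, b) ∈ ℤ² ∖ 0`, carries infinitely many independent
hits; (3) a fibre `eˣ = ω` carries infinitely many independent hits. -/
theorem stub_cuspEscape :
    ∀ (W : Set (Fin 2 ⊕ Fin 2 → ℂ)), IsDefinedOver (⊥ : Subfield ℂ) W → zariskiDim ℂ W < 2 →
      (indepExpPoints W).Infinite →
      (∃ (s : Fin 2 ≃ Fin 2) (e : ℕ) (A : Polynomial ℂ) (g ℓu ℓv : ℂ → ℂ) (ρ : ℝ),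
        let w : ℕ → ℂ := fun N => (((N : ℝ) ^ ((e : ℝ)⁻¹) : ℝ) : ℂ);
        let x : ℕ → Fin 2 → ℂ := fun N =>
          (![2 * ↑π * I * (N : ℂ) + ℓu (w N)⁻¹,
              2 * ↑π * I * (A.eval (w N) + g (w N)⁻¹) + ℓv (w N)⁻¹] : Fin 2 → ℂ) ∘ s;
        let y : ℕ → Fin 2 → ℂ := fun N =>
          (![Complex.exp (ℓu (w N)⁻¹), Complex.exp (ℓv (w N)⁻¹)] : Fin 2 → ℂ) ∘ s;
        0 < e ∧ 0 < ρ ∧ AnalyticAt ℂ g 0 ∧ g 0 = 0 ∧ AnalyticAt ℂ ℓu 0 ∧ AnalyticAt ℂ ℓv 0 ∧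
        (¬ ∃ P : MvPolynomial (Fin 2) ℂ, P ≠ 0 ∧
            ∀ᶠ z in 𝓝 (0 : ℂ), MvPolynomial.eval ![z, g z] P = 0) ∧
        (∀ σ : ℂ, 0 < ‖σ‖ → ‖σ‖ < ρ →
          Sum.elim ((![2 * ↑π * I * σ⁻¹ ^ e + ℓu σ,
                        2 * ↑π * I * (A.eval σ⁻¹ + g σ) + ℓv σ] : Fin 2 → ℂ) ∘ s)
            ((![Complex.exp (ℓu σ), Complex.exp (ℓv σ)] : Fin 2 → ℂ) ∘ s) ∈ W) ∧
        Set.Infinite {N : ℕ | x N ∈ indepExpPoints W ∧ Complex.exp ∘ x N = y N ∧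
          ∃ L : ℤ, A.eval (w N) + g (w N)⁻¹ = L}) ∨
      (∃ a b : ℤ, (a ≠ 0 ∨ b ≠ 0) ∧ ∃ c : ℂ,
        Set.Infinite {x : Fin 2 → ℂ | x ∈ indepExpPoints W ∧ (a : ℂ) * x 0 + (b : ℂ) * x 1 = c}) ∨
      (∃ ω : Fin 2 → ℂ,
        Set.Infinite {x : Fin 2 → ℂ | x ∈ indepExpPoints W ∧ Complex.exp ∘ x = ω}) := by
  intro W hW hdim hinf
  obtain ⟨i, hi⟩ := exists_unbounded_coord hdim hinf
  fin_cases i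
  · exact cuspEscape_of_unbounded_fst W hW hdim hi
  -- the second coordinate is unbounded: swap both coordinate blocks
  set σ : Fin 2 ≃ Fin 2 := Equiv.swap 0 1 with hσ
  set W' : Set (Fin 2 ⊕ Fin 2 → ℂ) := {z | z ∘ ⇑(Equiv.sumCongr σ σ) ∈ W} with hW'def
  have hW' : IsDefinedOver (⊥ : Subfield ℂ) W' := isDefinedOver_comp_equiv hW _
  have hdim' : zariskiDim ℂ W' < 2 := by rw [hW'def, zariskiDim_comp_equiv]; exact hdim
  have hss : ∀ z : Fin 2 → ℂ, (z ∘ σ) ∘ σ = z := fun z => by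
    funext j; fin_cases j <;> simp [hσ]
  have hinj : Function.Injective fun x : Fin 2 → ℂ => x ∘ σ := fun x y hxy => by
    have := congrArg (fun f : Fin 2 → ℂ => f ∘ σ) hxy
    simpa only [hss] using this
  have hmem : ∀ x : Fin 2 → ℂ, x ∈ indepExpPoints W → x ∘ σ ∈ indepExpPoints W' := by
    intro x hx
    rw [mem_indepExpPoints_comp_swap, hss]
    exact hx
  have h0' : ∀ R : ℝ, Set.Infinite {x : Fin 2 → ℂ | x ∈ indepExpPoints W' ∧ R < ‖x 0‖} := by
    intro R
    refine ((hi R).image hinj.injOn).mono ?_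
    rintro _ ⟨x, ⟨hxH, hxR⟩, rfl⟩
    exact ⟨hmem x hxH, by simpa [hσ] using hxR⟩
  rcases cuspEscape_of_unbounded_fst W' hW' hdim' h0' with h1 | h2 | h3
  · -- (1): compose the coordinate choice with the swap
    obtain ⟨s, e, A, g, ℓu, ℓv, ρ, he, hρ, hg, hg0, hℓu, hℓv, htr, hbr, hN⟩ := h1
    refine Or.inl ⟨σ.trans s, e, A, g, ℓu, ℓv, ρ, ?_⟩
    intro w x y
    refine ⟨he, hρ, hg, hg0, hℓu, hℓv, htr, fun τ hτ0 hτρ => ?_, ?_⟩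
    · have := hbr τ hτ0 hτρ
      rw [hW'def, Set.mem_setOf_eq, sumElim_comp_sumCongr] at this
      simpa only [Equiv.coe_trans, Function.comp_assoc] using this
    · simp only [w, x, y]
      refine hN.mono ?_
      rintro n ⟨hH, hexp, hL⟩
      refine ⟨?_, ?_, hL⟩
      · have := (mem_indepExpPoints_comp_swap σ).1 hH
        simpa only [Equiv.coe_trans, Function.comp_assoc] using this
      · have := congrArg (fun f : Fin 2 → ℂ => f ∘ σ) hexp
        simpa only [Equiv.coe_trans, Function.comp_assoc] using this
  · -- (2): the swapped section
    obtain ⟨a, b, hab, c, hinf2⟩ := h2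
    refine Or.inr (Or.inl ⟨b, a, hab.symm, c, ((hinf2.image hinj.injOn)).mono ?_⟩)
    rintro _ ⟨x, ⟨hxH, hxc⟩, rfl⟩
    refine ⟨(mem_indepExpPoints_comp_swap σ).1 hxH, ?_⟩
    simp only [Function.comp_apply, hσ, Equiv.swap_apply_left, Equiv.swap_apply_right]
    rw [← hxc]; ring
  · -- (3): the swapped fibre
    obtain ⟨ω, hinf3⟩ := h3
    refine Or.inr (Or.inr ⟨ω ∘ σ, (hinf3.image hinj.injOn).mono ?_⟩)
    rintro _ ⟨x, ⟨hxH, hxω⟩, rfl⟩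
    refine ⟨(mem_indepExpPoints_comp_swap σ).1 hxH, ?_⟩
    show (Complex.exp ∘ x) ∘ σ = ω ∘ σ
    rw [hxω]

end Summit.Schanuel.Schanuel.Cruxes.SparsityTwo.CuspGermSchneiderSparsity
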